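import Summits.BirchSwinnertonDyer.BirchSwinnertonDyer.Theorems.AdditiveKolyvaginRoadLevelSystemsDichotomyLowerOfLocalPackage
import Summits.BirchSwinnertonDyer.BirchSwinnertonDyer.Theorems.AdditiveKolyvaginRoadLevelSystemsDichotomyRaiseOfPoitouTate
import Summits.BirchSwinnertonDyer.BirchSwinnertonDyer.Theorems.AdditiveKolyvaginRoadLevelKolyvaginSystemsAdditiveOfKolyvaginPrimitiveOfTwin
import Summits.BirchSwinnertonDyer.BirchSwinnertonDyer.Theorems.AdditiveKolyvaginRoadKolyvaginPrimitiveOfLevelSystemsBotFree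
import HarnessLib

/-!
# Route `AdditiveKolyvaginRoad`, crux KS′ `LevelKolyvaginSystemsAdditive` (item stmt-BirchSwinnertonDyer-21396):
# THE CAPSTONE BY NAME — `PublishedInputsAdditiveKoly → PublishedDualityInputsAdditiveKoly →
#   (LevelKolyvaginSystemsAdditive ↔ KolyvaginPrimitiveAdditive)` with NO displayed E-side binder
# (cell `pub/bsd-wall`, lead prover `cruxlead-stmt-BirchSwinnertonDyer-21396` g3; `--supports stmt-BirchSwinnertonDyer-21396`, helper;
# director ruling W-84 (α) «KS′ is a corollary of KPA′; the lead lineage continues as a LINE reaching KPA′», in the kernel)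

WHAT.
* §1 (Twin) FROM (Lower) + (Raise), for any family `Mix m n μ ⊂ H¹(K, E[p])` with the membership DICTIONARY of the mixed level spaces (μ-eigen;
  Kummer at `∞` and off `m ∪ n`; toric on `n`; transverse on `m`), finite over `ZMod p`: membership transfers at a Kolyvagin prime (zero
  localisation is both Kummer and transverse) and `twin_of_dichotomy` ∕ `twin_of_localPackage_of_raise` = width seat akr-p2x-w2's binders
  `hDrop` ∕ `hRise` ∕ `hJump` FROM (Lower) (shape of lead g2's landed `selmerDichotomy_lower_of_localPackage`, p625481) + (Raise), parity-free
  (shape of akr-p2x-w3's landed `selmerDichotomy_raise_of_poitouTate`, p628088); pure logic + uniqueness of the place above an inert prime.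
* §2 `twin_of_poitouTate` — (Twin) at every ♯-type frame (`p ≥ 5`, `ρ̄` onto, `K` imaginary quadratic, `d_K < −4`, `c ≠ 1`) from the
  Poitou–Tate named fact alone; discharges the binder `hTwin` of akr-p2x-w2's p625738 ∕ p626643.
* §3 `nonempty_levelKolyvaginSystemP_of_kolyvaginClass_ne_zero_of_published` — FRAME-WISE socket: KS′'s fibre at a ♯ frame ⟸ PUB + DUAL + ONE
  non-zero Kolyvagin class mod `p` at that frame; **`levelKolyvaginSystemsAdditive_of_kolyvaginPrimitiveAdditive_of_published : PUB → DUAL →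
  KolyvaginPrimitiveAdditive → LevelKolyvaginSystemsAdditive`** and **`levelKolyvaginSystemsAdditive_iff_kolyvaginPrimitiveAdditive_of_published :
  PUB → DUAL → (LevelKolyvaginSystemsAdditive ↔ KolyvaginPrimitiveAdditive)`** (converse = the tree's BOT′-free kernel
  `kolyvaginPrimitiveAdditive_of_published_of_levelSystems`, akr-p1 lineage) — all BY NAME, no displayed binder.

READING (for the planners; the lead files no items). Modulo the route's two PUBLISHED bundles (PUB = item 20137's conjunction, DUAL = item 21333:
Cassels–Tate level inputs, Poitou–Tate for Selmer structures) the crux r8 KS′ (stmt-…-21396) and the target crux r2 KPA′ (stmt-…-21400) are ONE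
statement in the kernel (director ruling W-84 (α)). All E-side binders of the earlier sockets — lead g2's DICH (p624986) and akr-p2x-w2's (Twin)
(p626643) — are discharged on the (Twin) door; no level-direction (TwoStep) input is needed. Hence the REGISTERED skeleton
`Cruxes/KolyvaginPrimitiveAdditive/Lines/birth.lean` of crux r2 (stubs P, J2, LOC closed; KS = KS′) is circular. What remains of KS′ is exactly
KPA′: Kolyvagin's conjecture mod `p` at an additive `p ≥ 5` on the ♯ locus — open at `p² ∣ N` (print: `p ∤ N` W. Zhang 2014, `p ∥ N`
Skinner–Zhang 2014; tree: the good-avatar locus via Kriz–Li, frame by frame).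

HONEST FRAMING: theorems only; 0 definitions, 0 named facts, 0 `sorry`; CONDITIONAL on nothing beyond the displayed route items BY NAME.
Closes nothing: KS′ ⟺ KPA′ and KPA′ is OPEN. BSD is not proved by any of this; no summit statement is proved by this file.

References: [cite: WZhang2014, Thm. 1.1, Thm. 4.3, Lemma 5.3, Prop. 5.4, Thm. 7.2, §8.1 (8.1), Lemma 8.2, Lemma 8.4, §9]
[cite: Howard2004HeegnerKolyvagin, Lemma 2.5.3, Lemma 2.6.4] [cite: MazurRubin2004, Lemma 4.1.7, Thm. 2.3.4] [cite: McCallumLMS1991, Cor. 3.2]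
[cite: GrossLMS1991, §3–§4, Prop. 8.1] [cite: MilneADT2006, Ch. I, Thm. 4.10].
-/

set_option linter.dupNamespace false -- single-conjunct summit repeats the name by design

noncomputable section

open scoped Classical

namespace Summit.BirchSwinnertonDyer.BirchSwinnertonDyer.Theorems.AdditiveKoly

open WeierstrassCurve NumberField IsDedekindDomain Field
  Literature.NumberTheory.EllipticCurves Literature.NumberTheory.EllipticCurves.ModularForms
  Literature.NumberTheory.GaloisRepresentations Module
  Summit.BirchSwinnertonDyer.Rank1Residual.X11b.Three.Koly

/-! ## §1 (Twin) from (Lower) + (Raise), for any family with the mixed dictionary -/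

variable (W : WeierstrassCurve ℚ) (K : Type) [Field K] [NumberField K] (p : ℕ) [W.IsElliptic] [W.IsGloballyMinimal]
  [Fact p.Prime] (c : K ≃ₐ[ℚ] K) (ι : K →+* ℂ) [Module (ZMod p) (Vp W K p)]

omit [W.IsElliptic] [Fact p.Prime] [Module (ZMod p) (Vp W K p)] in
/-- The place of `K` above a Kolyvagin prime `ℓ` (inert in `K`) is unique. [cite: GrossLMS1991, §3] -/
theorem place_eq_of_kolyvaginPrime (ℓ : {ℓ // Zhang2014.IsKolyvaginPrime (W.conductorNorm ℤ) W K p ℓ})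
    {v v' : HeightOneSpectrum (𝓞 K)} (hv : ((ℓ : ℕ) : 𝓞 K) ∈ v.asIdeal) (hv' : ((ℓ : ℕ) : 𝓞 K) ∈ v'.asIdeal) : v' = v :=
  Method2.placesAbove_eq_of_isPrime_span K ℓ.2.2.2.2.2.1 ℓ.2.1.ne_zero hv hv'

variable
  (Mix : Finset {ℓ // Zhang2014.IsKolyvaginPrime (W.conductorNorm ℤ) W K p ℓ} → Finset (AdmQ W K p) → Bool →
    Submodule (ZMod p) (Vp W K p))
  (hMix : ∀ (m : Finset {ℓ // Zhang2014.IsKolyvaginPrime (W.conductorNorm ℤ) W K p ℓ}) (n : Finset (AdmQ W K p)) (μ : Bool)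
    (x : Vp W K p), x ∈ Mix m n μ ↔ (conjAct W c ((p ^ 1 : ℕ) : ℤ) x = sgnP μ • x ∧
      (∀ w : InfinitePlace K, x ∈ selmerLocalKer (W.baseChange K) w.Completion ((p ^ 1 : ℕ) : ℤ)) ∧
      (∀ v : HeightOneSpectrum (𝓞 K), (∀ ℓ ∈ m, ((ℓ : ℕ) : 𝓞 K) ∉ v.asIdeal) → (∀ q ∈ n, ((q : ℕ) : 𝓞 K) ∉ v.asIdeal) →
        x ∈ selmerLocalKer (W.baseChange K) (v.adicCompletion K) ((p ^ 1 : ℕ) : ℤ)) ∧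
      (∀ q ∈ n, ∀ v : HeightOneSpectrum (𝓞 K), ((q : ℕ) : 𝓞 K) ∈ v.asIdeal →
        x ∈ toricLocalKer (W.baseChange K) (v.adicCompletion K) ((p ^ 1 : ℕ) : ℤ)) ∧
      (∀ ℓ ∈ m, ∀ v : HeightOneSpectrum (𝓞 K), ((ℓ : ℕ) : 𝓞 K) ∈ v.asIdeal → x ∈ transverseLocalKerP W K p ι ℓ v)))

include hMix

section Membership

/-- **Membership transfer, Kummer ⟶ transverse.** For a Kolyvagin prime `ℓ ∉ m`, a class of `Mix m n μ` whose localisation above `ℓ` is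
ZERO lies in `Mix (insert ℓ m) n μ` (zero localisation is transverse: `torsionLocalKer_le_transverseLocalKerP`; the other rows of the
dictionary are inherited, the Kummer row on the smaller set of places). [cite: WZhang2014, §8.1] -/
theorem mem_mixed_insert_of_forall_mem_torsionLocalKer
    {m : Finset {ℓ // Zhang2014.IsKolyvaginPrime (W.conductorNorm ℤ) W K p ℓ}}
    {ℓ : {ℓ // Zhang2014.IsKolyvaginPrime (W.conductorNorm ℤ) W K p ℓ}} {n : Finset (AdmQ W K p)} {μ : Bool} {x : Vp W K p}
    (hx : x ∈ Mix m n μ)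
    (hloc : ∀ v : HeightOneSpectrum (𝓞 K), ((ℓ : ℕ) : 𝓞 K) ∈ v.asIdeal →
      x ∈ (W.baseChange K).torsionLocalKer (v.adicCompletion K) ((p ^ 1 : ℕ) : ℤ)) :
    x ∈ Mix (insert ℓ m) n μ := by
  obtain ⟨hsgn, hinf, hkum, htor, htr⟩ := (hMix m n μ x).mp hx
  refine (hMix (insert ℓ m) n μ x).mpr ⟨hsgn, hinf, fun v hm hn ↦ ?_, htor, fun ℓ' hℓ' v hv ↦ ?_⟩
  · exact hkum v (fun ℓ' hℓ' ↦ hm ℓ' (Finset.mem_insert_of_mem hℓ')) hn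
  · rcases Finset.mem_insert.mp hℓ' with rfl | hℓ'm
    · exact torsionLocalKer_le_transverseLocalKerP W K p ι _ v (hloc v hv)
    · exact htr ℓ' hℓ'm v hv

omit [W.IsElliptic] in
/-- **Membership transfer, transverse ⟶ Kummer.** A class of `Mix (insert ℓ m) n μ` whose localisation above `ℓ` is ZERO lies in
`Mix m n μ` (zero localisation is Kummer: `torsionLocalKer_le_selmerLocalKer`; at a place above no prime of `insert ℓ m` the Kummer row
is inherited). [cite: WZhang2014, §8.1] -/
theorem mem_mixed_of_mem_insert_of_forall_mem_torsionLocalKer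
    {m : Finset {ℓ // Zhang2014.IsKolyvaginPrime (W.conductorNorm ℤ) W K p ℓ}}
    {ℓ : {ℓ // Zhang2014.IsKolyvaginPrime (W.conductorNorm ℤ) W K p ℓ}} {n : Finset (AdmQ W K p)} {μ : Bool} {y : Vp W K p}
    (hy : y ∈ Mix (insert ℓ m) n μ)
    (hloc : ∀ v : HeightOneSpectrum (𝓞 K), ((ℓ : ℕ) : 𝓞 K) ∈ v.asIdeal →
      y ∈ (W.baseChange K).torsionLocalKer (v.adicCompletion K) ((p ^ 1 : ℕ) : ℤ)) :
    y ∈ Mix m n μ := by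
  obtain ⟨hsgn, hinf, hkum, htor, htr⟩ := (hMix (insert ℓ m) n μ y).mp hy
  refine (hMix m n μ y).mpr ⟨hsgn, hinf, fun v hm hn ↦ ?_, htor, fun ℓ' hℓ' v hv ↦ htr ℓ' (Finset.mem_insert_of_mem hℓ') v hv⟩
  by_cases hv : ((ℓ : ℕ) : 𝓞 K) ∈ v.asIdeal
  · exact (W.baseChange K).torsionLocalKer_le_selmerLocalKer (v.adicCompletion K) _ (hloc v hv)
  · refine hkum v (fun ℓ' hℓ' ↦ ?_) hn
    rcases Finset.mem_insert.mp hℓ' with rfl | hℓ'm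
    · exact hv
    · exact hm ℓ' hℓ'm

end Membership

/-- **(Twin) FROM (Lower) + (Raise).** For the mixed level spaces `Mix` (membership dictionary, finite-dimensional), the conductor-direction
dichotomy at a Kolyvagin prime `ℓ ∉ m` above the place `v` — (Lower): a class of `Mix m n μ` is detected at `v` ⟹ every class of
`Mix (insert ℓ m) n μ` dies at `v` and `dim Mix (insert ℓ m) n μ + 1 = dim Mix m n μ`; (Raise), parity-free in the level: every class of
`Mix m n μ` dies at `v` ⟹ `dim Mix (insert ℓ m) n μ = dim Mix m n μ + 1` — gives w2's TWIN DICHOTOMY at every non-empty level: `hDrop`,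
`hRise` (with the membership identities `Mix (ℓm) = Mix m ∩ ker loc_ℓ`, resp. `Mix m = Mix (ℓm) ∩ ker loc_ℓ`) and `hJump`. Pure logic over the
dictionary: the membership transfers above, uniqueness of the place above the inert prime `ℓ`, and `dim` monotonicity.
[cite: Howard2004HeegnerKolyvagin, Lemma 2.5.3] [cite: MazurRubin2004, Lemma 4.1.7] [cite: WZhang2014, Lemma 8.2, Lemma 8.4] -/
theorem twin_of_dichotomy
    (hfin : ∀ (m : Finset {ℓ // Zhang2014.IsKolyvaginPrime (W.conductorNorm ℤ) W K p ℓ}) (n : Finset (AdmQ W K p)) (μ : Bool),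
      Module.Finite (ZMod p) (Mix m n μ))
    (hLower : ∀ (n : Finset (AdmQ W K p)) (m : Finset {ℓ // Zhang2014.IsKolyvaginPrime (W.conductorNorm ℤ) W K p ℓ})
      (ℓ : {ℓ // Zhang2014.IsKolyvaginPrime (W.conductorNorm ℤ) W K p ℓ}) (μ : Bool) (v : HeightOneSpectrum (𝓞 K)),
      ℓ ∉ m → ((ℓ : ℕ) : 𝓞 K) ∈ v.asIdeal →
      (∃ x ∈ Mix m n μ, x ∉ (W.baseChange K).torsionLocalKer (v.adicCompletion K) ((p ^ 1 : ℕ) : ℤ)) →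
      (∀ y ∈ Mix (insert ℓ m) n μ, y ∈ (W.baseChange K).torsionLocalKer (v.adicCompletion K) ((p ^ 1 : ℕ) : ℤ)) ∧
        finrank (ZMod p) (Mix (insert ℓ m) n μ) + 1 = finrank (ZMod p) (Mix m n μ))
    (hRaise : ∀ (n : Finset (AdmQ W K p)), n.Nonempty →
      ∀ (m : Finset {ℓ // Zhang2014.IsKolyvaginPrime (W.conductorNorm ℤ) W K p ℓ})
      (ℓ : {ℓ // Zhang2014.IsKolyvaginPrime (W.conductorNorm ℤ) W K p ℓ}) (μ : Bool) (v : HeightOneSpectrum (𝓞 K)),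
      ℓ ∉ m → ((ℓ : ℕ) : 𝓞 K) ∈ v.asIdeal →
      (∀ x ∈ Mix m n μ, x ∈ (W.baseChange K).torsionLocalKer (v.adicCompletion K) ((p ^ 1 : ℕ) : ℤ)) →
      finrank (ZMod p) (Mix (insert ℓ m) n μ) = finrank (ZMod p) (Mix m n μ) + 1) :
    (∀ (m : Finset {ℓ // Zhang2014.IsKolyvaginPrime (W.conductorNorm ℤ) W K p ℓ})
        (ℓ : {ℓ // Zhang2014.IsKolyvaginPrime (W.conductorNorm ℤ) W K p ℓ}) (n : Finset (AdmQ W K p)) (μ : Bool), ℓ ∉ m → n.Nonempty →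
      (∃ x ∈ Mix m n μ, ¬ (∀ v : HeightOneSpectrum (𝓞 K), ((ℓ : ℕ) : 𝓞 K) ∈ v.asIdeal →
        x ∈ (W.baseChange K).torsionLocalKer (v.adicCompletion K) ((p ^ 1 : ℕ) : ℤ))) →
      (∀ y, y ∈ Mix (insert ℓ m) n μ ↔ (y ∈ Mix m n μ ∧ (∀ v : HeightOneSpectrum (𝓞 K), ((ℓ : ℕ) : 𝓞 K) ∈ v.asIdeal →
        y ∈ (W.baseChange K).torsionLocalKer (v.adicCompletion K) ((p ^ 1 : ℕ) : ℤ)))) ∧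
        finrank (ZMod p) (Mix (insert ℓ m) n μ) + 1 = finrank (ZMod p) (Mix m n μ)) ∧
    (∀ (m : Finset {ℓ // Zhang2014.IsKolyvaginPrime (W.conductorNorm ℤ) W K p ℓ})
        (ℓ : {ℓ // Zhang2014.IsKolyvaginPrime (W.conductorNorm ℤ) W K p ℓ}) (n : Finset (AdmQ W K p)) (μ : Bool), ℓ ∉ m → n.Nonempty →
      (∃ y ∈ Mix (insert ℓ m) n μ, ¬ (∀ v : HeightOneSpectrum (𝓞 K), ((ℓ : ℕ) : 𝓞 K) ∈ v.asIdeal →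
        y ∈ (W.baseChange K).torsionLocalKer (v.adicCompletion K) ((p ^ 1 : ℕ) : ℤ))) →
      (∀ x, x ∈ Mix m n μ ↔ (x ∈ Mix (insert ℓ m) n μ ∧ (∀ v : HeightOneSpectrum (𝓞 K), ((ℓ : ℕ) : 𝓞 K) ∈ v.asIdeal →
        x ∈ (W.baseChange K).torsionLocalKer (v.adicCompletion K) ((p ^ 1 : ℕ) : ℤ)))) ∧
        finrank (ZMod p) (Mix m n μ) + 1 = finrank (ZMod p) (Mix (insert ℓ m) n μ)) ∧
    (∀ (m : Finset {ℓ // Zhang2014.IsKolyvaginPrime (W.conductorNorm ℤ) W K p ℓ})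
        (ℓ : {ℓ // Zhang2014.IsKolyvaginPrime (W.conductorNorm ℤ) W K p ℓ}) (n : Finset (AdmQ W K p)) (μ : Bool), ℓ ∉ m → n.Nonempty →
      (∃ x ∈ Mix m n μ, ¬ (∀ v : HeightOneSpectrum (𝓞 K), ((ℓ : ℕ) : 𝓞 K) ∈ v.asIdeal →
        x ∈ (W.baseChange K).torsionLocalKer (v.adicCompletion K) ((p ^ 1 : ℕ) : ℤ))) ∨
      (∃ y ∈ Mix (insert ℓ m) n μ, ¬ (∀ v : HeightOneSpectrum (𝓞 K), ((ℓ : ℕ) : 𝓞 K) ∈ v.asIdeal →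
        y ∈ (W.baseChange K).torsionLocalKer (v.adicCompletion K) ((p ^ 1 : ℕ) : ℤ)))) := by
  -- the undetected case at the (unique) place `v` above `ℓ`: (Raise) gives the rise AND both membership identities
  have key_undetected : ∀ (m : Finset {ℓ // Zhang2014.IsKolyvaginPrime (W.conductorNorm ℤ) W K p ℓ})
      (ℓ : {ℓ // Zhang2014.IsKolyvaginPrime (W.conductorNorm ℤ) W K p ℓ}) (n : Finset (AdmQ W K p)) (μ : Bool)
      (v : HeightOneSpectrum (𝓞 K)), ℓ ∉ m → n.Nonempty → ((ℓ : ℕ) : 𝓞 K) ∈ v.asIdeal →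
      (∀ x ∈ Mix m n μ, x ∈ (W.baseChange K).torsionLocalKer (v.adicCompletion K) ((p ^ 1 : ℕ) : ℤ)) →
      ∃ y ∈ Mix (insert ℓ m) n μ, y ∉ (W.baseChange K).torsionLocalKer (v.adicCompletion K) ((p ^ 1 : ℕ) : ℤ) := by
    intro m ℓ n μ v hℓm hn hv hall
    by_contra hnone
    push Not at hnone
    -- then `Mix (ℓm) ≤ Mix m`, contradicting the rise of the dimension
    have hle : Mix (insert ℓ m) n μ ≤ Mix m n μ := fun y hy ↦
      mem_mixed_of_mem_insert_of_forall_mem_torsionLocalKer W K p c ι Mix hMix hy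
        (fun v' hv' ↦ by rw [place_eq_of_kolyvaginPrime W K p ℓ hv hv']; exact hnone y hy)
    haveI := hfin m n μ
    have hmono := Submodule.finrank_mono hle
    have hr := hRaise n hn m ℓ μ v hℓm hv hall
    omega
  refine ⟨fun m ℓ n μ hℓm hn hdet ↦ ?_, fun m ℓ n μ hℓm hn hdet ↦ ?_, fun m ℓ n μ hℓm hn ↦ ?_⟩
  · -- hDrop
    obtain ⟨x, hx, hxdet⟩ := hdet
    push Not at hxdet
    obtain ⟨v, hv, hxv⟩ := hxdet
    obtain ⟨hdies, hdim⟩ := hLower n m ℓ μ v hℓm hv ⟨x, hx, hxv⟩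
    refine ⟨fun y ↦ ⟨fun hy ↦ ?_, fun ⟨hy, hyloc⟩ ↦ ?_⟩, hdim⟩
    · have hyloc : ∀ v' : HeightOneSpectrum (𝓞 K), ((ℓ : ℕ) : 𝓞 K) ∈ v'.asIdeal →
          y ∈ (W.baseChange K).torsionLocalKer (v'.adicCompletion K) ((p ^ 1 : ℕ) : ℤ) :=
        fun v' hv' ↦ by rw [place_eq_of_kolyvaginPrime W K p ℓ hv hv']; exact hdies y hy
      exact ⟨mem_mixed_of_mem_insert_of_forall_mem_torsionLocalKer W K p c ι Mix hMix hy hyloc, hyloc⟩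
    · exact mem_mixed_insert_of_forall_mem_torsionLocalKer W K p c ι Mix hMix hy hyloc
  · -- hRise
    obtain ⟨y, hy, hydet⟩ := hdet
    push Not at hydet
    obtain ⟨v, hv, hyv⟩ := hydet
    -- no class of `Mix m` is detected at `v` (else (Lower) kills `y`)
    have hall : ∀ x ∈ Mix m n μ, x ∈ (W.baseChange K).torsionLocalKer (v.adicCompletion K) ((p ^ 1 : ℕ) : ℤ) := by
      by_contra hsome
      push Not at hsome
      obtain ⟨x, hx, hxv⟩ := hsome
      exact hyv ((hLower n m ℓ μ v hℓm hv ⟨x, hx, hxv⟩).1 y hy)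
    refine ⟨fun x ↦ ⟨fun hx ↦ ?_, fun ⟨hx, hxloc⟩ ↦ ?_⟩, (hRaise n hn m ℓ μ v hℓm hv hall).symm⟩
    · have hxloc : ∀ v' : HeightOneSpectrum (𝓞 K), ((ℓ : ℕ) : 𝓞 K) ∈ v'.asIdeal →
          x ∈ (W.baseChange K).torsionLocalKer (v'.adicCompletion K) ((p ^ 1 : ℕ) : ℤ) :=
        fun v' hv' ↦ by rw [place_eq_of_kolyvaginPrime W K p ℓ hv hv']; exact hall x hx
      exact ⟨mem_mixed_insert_of_forall_mem_torsionLocalKer W K p c ι Mix hMix hx hxloc, hxloc⟩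
    · exact mem_mixed_of_mem_insert_of_forall_mem_torsionLocalKer W K p c ι Mix hMix hx hxloc
  · -- hJump
    by_contra hboth
    push Not at hboth
    obtain ⟨hm, hℓm'⟩ := hboth
    obtain ⟨v, hv⟩ := exists_place_of_kolyvaginPrime W K p ℓ
    obtain ⟨y, hy, hyv⟩ := key_undetected m ℓ n μ v hℓm hn hv (fun x hx ↦ hm x hx v hv)
    exact hyv (hℓm' y hy v hv)

variable [∀ v : Place K, Module (ZMod p)
    (galoisCohomology (((W.baseChange K).torsionGaloisModule ((p ^ 1 : ℕ) : ℤ)).toLocal v) 1)] in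
/-- **(Twin) FROM THE LOCAL–GLOBAL PACKAGE + (Raise).** The same, with (Lower) DISCHARGED by the landed
`selmerDichotomy_lower_of_localPackage` (p625481) from the route's package `KolyvaginLocalPackageP W K p ι c` (itself ⟸ Poitou–Tate at a
♯-type frame: `kolyvaginLocalPackageP_of_poitouTate`), so that the ONE displayed conductor-direction binder is (Raise), parity-free in the level.
[cite: WZhang2014, §8.1, Lemma 8.2, Lemma 8.4] [cite: Howard2004HeegnerKolyvagin, Lemma 2.5.3] -/
theorem twin_of_localPackage_of_raise (Lp : KolyvaginLocalPackageP W K p ι c)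
    (hfin : ∀ (m : Finset {ℓ // Zhang2014.IsKolyvaginPrime (W.conductorNorm ℤ) W K p ℓ}) (n : Finset (AdmQ W K p)) (μ : Bool),
      Module.Finite (ZMod p) (Mix m n μ))
    (hRaise : ∀ (n : Finset (AdmQ W K p)), n.Nonempty →
      ∀ (m : Finset {ℓ // Zhang2014.IsKolyvaginPrime (W.conductorNorm ℤ) W K p ℓ})
      (ℓ : {ℓ // Zhang2014.IsKolyvaginPrime (W.conductorNorm ℤ) W K p ℓ}) (μ : Bool) (v : HeightOneSpectrum (𝓞 K)),
      ℓ ∉ m → ((ℓ : ℕ) : 𝓞 K) ∈ v.asIdeal →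
      (∀ x ∈ Mix m n μ, x ∈ (W.baseChange K).torsionLocalKer (v.adicCompletion K) ((p ^ 1 : ℕ) : ℤ)) →
      finrank (ZMod p) (Mix (insert ℓ m) n μ) = finrank (ZMod p) (Mix m n μ) + 1) :
    (∀ (m : Finset {ℓ // Zhang2014.IsKolyvaginPrime (W.conductorNorm ℤ) W K p ℓ})
        (ℓ : {ℓ // Zhang2014.IsKolyvaginPrime (W.conductorNorm ℤ) W K p ℓ}) (n : Finset (AdmQ W K p)) (μ : Bool), ℓ ∉ m → n.Nonempty →
      (∃ x ∈ Mix m n μ, ¬ (∀ v : HeightOneSpectrum (𝓞 K), ((ℓ : ℕ) : 𝓞 K) ∈ v.asIdeal →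
        x ∈ (W.baseChange K).torsionLocalKer (v.adicCompletion K) ((p ^ 1 : ℕ) : ℤ))) →
      (∀ y, y ∈ Mix (insert ℓ m) n μ ↔ (y ∈ Mix m n μ ∧ (∀ v : HeightOneSpectrum (𝓞 K), ((ℓ : ℕ) : 𝓞 K) ∈ v.asIdeal →
        y ∈ (W.baseChange K).torsionLocalKer (v.adicCompletion K) ((p ^ 1 : ℕ) : ℤ)))) ∧
        finrank (ZMod p) (Mix (insert ℓ m) n μ) + 1 = finrank (ZMod p) (Mix m n μ)) ∧
    (∀ (m : Finset {ℓ // Zhang2014.IsKolyvaginPrime (W.conductorNorm ℤ) W K p ℓ})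
        (ℓ : {ℓ // Zhang2014.IsKolyvaginPrime (W.conductorNorm ℤ) W K p ℓ}) (n : Finset (AdmQ W K p)) (μ : Bool), ℓ ∉ m → n.Nonempty →
      (∃ y ∈ Mix (insert ℓ m) n μ, ¬ (∀ v : HeightOneSpectrum (𝓞 K), ((ℓ : ℕ) : 𝓞 K) ∈ v.asIdeal →
        y ∈ (W.baseChange K).torsionLocalKer (v.adicCompletion K) ((p ^ 1 : ℕ) : ℤ))) →
      (∀ x, x ∈ Mix m n μ ↔ (x ∈ Mix (insert ℓ m) n μ ∧ (∀ v : HeightOneSpectrum (𝓞 K), ((ℓ : ℕ) : 𝓞 K) ∈ v.asIdeal →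
        x ∈ (W.baseChange K).torsionLocalKer (v.adicCompletion K) ((p ^ 1 : ℕ) : ℤ)))) ∧
        finrank (ZMod p) (Mix m n μ) + 1 = finrank (ZMod p) (Mix (insert ℓ m) n μ)) ∧
    (∀ (m : Finset {ℓ // Zhang2014.IsKolyvaginPrime (W.conductorNorm ℤ) W K p ℓ})
        (ℓ : {ℓ // Zhang2014.IsKolyvaginPrime (W.conductorNorm ℤ) W K p ℓ}) (n : Finset (AdmQ W K p)) (μ : Bool), ℓ ∉ m → n.Nonempty →
      (∃ x ∈ Mix m n μ, ¬ (∀ v : HeightOneSpectrum (𝓞 K), ((ℓ : ℕ) : 𝓞 K) ∈ v.asIdeal →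
        x ∈ (W.baseChange K).torsionLocalKer (v.adicCompletion K) ((p ^ 1 : ℕ) : ℤ))) ∨
      (∃ y ∈ Mix (insert ℓ m) n μ, ¬ (∀ v : HeightOneSpectrum (𝓞 K), ((ℓ : ℕ) : 𝓞 K) ∈ v.asIdeal →
        y ∈ (W.baseChange K).torsionLocalKer (v.adicCompletion K) ((p ^ 1 : ℕ) : ℤ)))) :=
  twin_of_dichotomy W K p c ι Mix hMix hfin
    (selmerDichotomy_lower_of_localPackage W K p ι c Lp (fun n m μ ↦ Mix m n μ) (fun n m μ x ↦ hMix m n μ x)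
      (fun n m μ ↦ hfin m n μ))
    hRaise

end Summit.BirchSwinnertonDyer.BirchSwinnertonDyer.Theorems.AdditiveKoly

namespace Summit.BirchSwinnertonDyer.BirchSwinnertonDyer.Theorems.AdditiveKoly

open WeierstrassCurve NumberField IsDedekindDomain Field
  Literature.NumberTheory.EllipticCurves Literature.NumberTheory.EllipticCurves.ModularForms
  Literature.NumberTheory.EllipticCurves.Rank1Residual Literature.NumberTheory.GaloisRepresentations Module
  Summit.BirchSwinnertonDyer.Rank1Residual.X11b.Three.Koly
  Summit.BirchSwinnertonDyer.BirchSwinnertonDyer.Theses.AdditiveKolyvaginRoad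

/-! ## §2 (Twin) from Poitou–Tate at a ♯-type frame -/

/-- **(Twin) from Poitou–Tate at a ♯-type frame.** For `E = W` globally minimal, `p ≥ 5` with `ρ̄_{E,p}` onto, `K` imaginary quadratic
with `d_K < −4`, a complex conjugation `c ≠ 1`, and the Poitou–Tate named fact for Selmer structures over `K`: for EVERY family `Mix m n μ` with
the membership dictionary of the mixed level spaces (μ-eigen; Kummer at `∞` and off `m ∪ n`; toric on `n`; transverse on `m`), finite over
`ZMod p`, the twin dichotomy {Drop, Rise, Jump} holds at every Kolyvagin prime `ℓ ∉ m` and every non-empty level `n` — exactly the binder `hTwin`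
of `levelKolyvaginSystemsAdditive_of_kolyvaginPrimitive_of_twin`. Proof: the unique `ZMod p`-structures on the local `H¹(K_v, E[p])`; the
package `kolyvaginLocalPackageP_of_poitouTate` gives (Lower) (`selmerDichotomy_lower_of_localPackage`); `selmerDichotomy_raise_of_poitouTate` gives
(Raise); `twin_of_localPackage_of_raise` assembles. [cite: Howard2004HeegnerKolyvagin, Lemma 2.5.3] [cite: WZhang2014, Lemma 8.2, Lemma 8.4]
[cite: MazurRubin2004, Lemma 4.1.7] -/
theorem twin_of_poitouTate (W : WeierstrassCurve ℚ) [W.IsElliptic] [W.IsGloballyMinimal] [NeZero (W.conductorNorm ℤ)] (p : ℕ)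
    [Fact p.Prime] (K : Type) [Field K] [NumberField K] (c : K ≃ₐ[ℚ] K) (ι : K →+* ℂ)
    (hp5 : 5 ≤ p) (hsurj : W.HasSurjectiveModNGaloisRep p) (hK : IsImaginaryQuadratic K) (hd : NumberField.discr K < -4) (hc1 : c ≠ 1)
    (hPT : Literature.NumberTheory.GaloisCohomology.poitouTate_selmerStructure_duality K)
    [Module (ZMod p) (Vp W K p)]
    (Mix : Finset {ℓ // Zhang2014.IsKolyvaginPrime (W.conductorNorm ℤ) W K p ℓ} → Finset (AdmQ W K p) → Bool → Submodule (ZMod p) (Vp W K p))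
    (hMix : ∀ (m : Finset {ℓ // Zhang2014.IsKolyvaginPrime (W.conductorNorm ℤ) W K p ℓ}) (n : Finset (AdmQ W K p)) (μ : Bool) (x : Vp W K p),
      x ∈ Mix m n μ ↔ (conjAct W c ((p ^ 1 : ℕ) : ℤ) x = sgnP μ • x ∧
        (∀ w : InfinitePlace K, x ∈ selmerLocalKer (W.baseChange K) w.Completion ((p ^ 1 : ℕ) : ℤ)) ∧
        (∀ v : HeightOneSpectrum (𝓞 K), (∀ ℓ ∈ m, ((ℓ : ℕ) : 𝓞 K) ∉ v.asIdeal) → (∀ q ∈ n, ((q : ℕ) : 𝓞 K) ∉ v.asIdeal) →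
          x ∈ selmerLocalKer (W.baseChange K) (v.adicCompletion K) ((p ^ 1 : ℕ) : ℤ)) ∧
        (∀ q ∈ n, ∀ v : HeightOneSpectrum (𝓞 K), ((q : ℕ) : 𝓞 K) ∈ v.asIdeal →
          x ∈ toricLocalKer (W.baseChange K) (v.adicCompletion K) ((p ^ 1 : ℕ) : ℤ)) ∧
        (∀ ℓ ∈ m, ∀ v : HeightOneSpectrum (𝓞 K), ((ℓ : ℕ) : 𝓞 K) ∈ v.asIdeal → x ∈ transverseLocalKerP W K p ι ℓ v)))
    (hfin : ∀ (m : Finset {ℓ // Zhang2014.IsKolyvaginPrime (W.conductorNorm ℤ) W K p ℓ}) (n : Finset (AdmQ W K p)) (μ : Bool),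
      Module.Finite (ZMod p) (Mix m n μ)) :
    (∀ (m : Finset {ℓ // Zhang2014.IsKolyvaginPrime (W.conductorNorm ℤ) W K p ℓ})
        (ℓ : {ℓ // Zhang2014.IsKolyvaginPrime (W.conductorNorm ℤ) W K p ℓ}) (n : Finset (AdmQ W K p)) (μ : Bool), ℓ ∉ m → n.Nonempty →
      (∃ x ∈ Mix m n μ, ¬ (∀ v : HeightOneSpectrum (𝓞 K), ((ℓ : ℕ) : 𝓞 K) ∈ v.asIdeal →
        x ∈ (W.baseChange K).torsionLocalKer (v.adicCompletion K) ((p ^ 1 : ℕ) : ℤ))) →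
      (∀ y, y ∈ Mix (insert ℓ m) n μ ↔ (y ∈ Mix m n μ ∧ (∀ v : HeightOneSpectrum (𝓞 K), ((ℓ : ℕ) : 𝓞 K) ∈ v.asIdeal →
        y ∈ (W.baseChange K).torsionLocalKer (v.adicCompletion K) ((p ^ 1 : ℕ) : ℤ)))) ∧
        finrank (ZMod p) (Mix (insert ℓ m) n μ) + 1 = finrank (ZMod p) (Mix m n μ)) ∧
    (∀ (m : Finset {ℓ // Zhang2014.IsKolyvaginPrime (W.conductorNorm ℤ) W K p ℓ})
        (ℓ : {ℓ // Zhang2014.IsKolyvaginPrime (W.conductorNorm ℤ) W K p ℓ}) (n : Finset (AdmQ W K p)) (μ : Bool), ℓ ∉ m → n.Nonempty →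
      (∃ y ∈ Mix (insert ℓ m) n μ, ¬ (∀ v : HeightOneSpectrum (𝓞 K), ((ℓ : ℕ) : 𝓞 K) ∈ v.asIdeal →
        y ∈ (W.baseChange K).torsionLocalKer (v.adicCompletion K) ((p ^ 1 : ℕ) : ℤ))) →
      (∀ x, x ∈ Mix m n μ ↔ (x ∈ Mix (insert ℓ m) n μ ∧ (∀ v : HeightOneSpectrum (𝓞 K), ((ℓ : ℕ) : 𝓞 K) ∈ v.asIdeal →
        x ∈ (W.baseChange K).torsionLocalKer (v.adicCompletion K) ((p ^ 1 : ℕ) : ℤ)))) ∧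
        finrank (ZMod p) (Mix m n μ) + 1 = finrank (ZMod p) (Mix (insert ℓ m) n μ)) ∧
    (∀ (m : Finset {ℓ // Zhang2014.IsKolyvaginPrime (W.conductorNorm ℤ) W K p ℓ})
        (ℓ : {ℓ // Zhang2014.IsKolyvaginPrime (W.conductorNorm ℤ) W K p ℓ}) (n : Finset (AdmQ W K p)) (μ : Bool), ℓ ∉ m → n.Nonempty →
      (∃ x ∈ Mix m n μ, ¬ (∀ v : HeightOneSpectrum (𝓞 K), ((ℓ : ℕ) : 𝓞 K) ∈ v.asIdeal →
        x ∈ (W.baseChange K).torsionLocalKer (v.adicCompletion K) ((p ^ 1 : ℕ) : ℤ))) ∨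
      (∃ y ∈ Mix (insert ℓ m) n μ, ¬ (∀ v : HeightOneSpectrum (𝓞 K), ((ℓ : ℕ) : 𝓞 K) ∈ v.asIdeal →
        y ∈ (W.baseChange K).torsionLocalKer (v.adicCompletion K) ((p ^ 1 : ℕ) : ℤ)))) := by
  have hp : p.Prime := Fact.out
  have hp2 : p ≠ 2 := by omega
  -- the unique `ZMod p`-module structures on the local `H¹(K_v, E[p])`
  letI : ∀ v : Place K, Module (ZMod p)
      (galoisCohomology (((W.baseChange K).torsionGaloisModule ((p ^ 1 : ℕ) : ℤ)).toLocal v) 1) := fun v ↦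
    AddCommGroup.zmodModule (fun x ↦ by
      have h := galoisCohomology.nsmul_eq_zero_of_forall
        (((W.baseChange K).torsionGaloisModule ((p ^ 1 : ℕ) : ℤ)).toLocal v) (n := p ^ 1)
        (fun m => AddSubgroup.torsionBy.nsmul m) x
      simpa using h)
  -- cup products need compact absolute Galois groups; `E[p](K̄)` is finite
  haveI : NeZero (p ^ 1 : ℕ) := ⟨pow_ne_zero 1 hp.ne_zero⟩
  haveI : ∀ v : Place K, CompactSpace (absoluteGaloisGroup (Place.Completion v)) := fun v ↦
    absoluteGaloisGroup_compactSpace _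
  haveI : Finite (geomTorsion (W.baseChange K) ((p ^ 1 : ℕ) : ℤ)) :=
    finite_geomTorsion_of_neZero (W.baseChange K) (p ^ 1)
  obtain ⟨Lp⟩ := kolyvaginLocalPackageP_of_poitouTate W K p ι c hK hp2 hd hsurj hc1 hPT
  exact twin_of_localPackage_of_raise W K p c ι Mix hMix Lp hfin
    (selmerDichotomy_raise_of_poitouTate W K p ι c hK hp2 hd hsurj hc1 hPT (fun n m μ ↦ Mix m n μ)
      (fun n m μ x ↦ hMix m n μ x) (fun n m μ ↦ hfin m n μ))

/-! ## §3 The capstone: frame-wise socket and the by-name statements -/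

/-- **KS′'s fibre at a ♯ frame FROM one non-zero Kolyvagin class at that frame, PUB and DUAL — no displayed E-side binder.** At a ♯ rank-one
additive frame of the route (`p ≥ 5`, `Addv`, `ρ̄` onto, ♠(1), ♠(2), `p ∤ ∏c`, `r_an = 1`, `K` imaginary quadratic with `d_K` odd `< −4`, Heegner
for `N_E`, `L(E^{d_K},1) ≠ 0`, `4N ∣ β² − d_K`, `p ∤ c(Dt)`): if SOME Kolyvagin–Heegner datum of Kolyvagin-prime conductor has non-zero class mod `p`
(the conclusion of crux r2 `KolyvaginPrimitiveAdditive` AT THIS FRAME), then `Nonempty (LevelKolyvaginSystemP W K p Dt β ι c)` for every complex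
conjugation `c ≠ 1` and every `ZMod p`-structure. Proof = width seat akr-p2x-w2's engine `nonempty_levelKolyvaginSystemP_of_seed_of_twin` (p625738)
fed with: the seed; Poitou–Tate = DUAL.2; the odd bottom rank from PUB + Cassels–Tate (`odd_finrank_selQP_empty_of_published`); the mixed spaces
(`exists_mixedSpaces`); and (Twin) for them, now a THEOREM (`twin_of_poitouTate`). The frame-wise socket every locus result plugs into (e.g. the
Kriz–Li seed on the good-avatar locus). [cite: WZhang2014, Thm. 4.3, Thm. 7.2, §8.1, §9] [cite: Howard2004HeegnerKolyvagin, Lemma 2.5.3, Lemma 2.6.4]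
[cite: McCallumLMS1991, Cor. 3.2] -/
theorem nonempty_levelKolyvaginSystemP_of_kolyvaginClass_ne_zero_of_published (hPUB : PublishedInputsAdditiveKoly)
    (hDual : PublishedDualityInputsAdditiveKoly)
    (W : WeierstrassCurve ℚ) [W.IsElliptic] [W.IsGloballyMinimal] [NeZero (W.conductorNorm ℤ)]
    (p : ℕ) [Fact p.Prime] (K : Type) [Field K] [NumberField K]
    (Dt : ModularParametrizationData W (W.conductorNorm ℤ)) (β : ℤ) (ι : K →+* ℂ)
    (hp5 : 5 ≤ p) (hadd : Addv W p) (hs : W.HasSurjectiveModNGaloisRep p)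
    (hsp : ∀ (ℓ : ℕ) [Fact ℓ.Prime], W.HasMultiplicativeReductionAtPrime ℓ → ¬ p ∣ padicValInt ℓ W.minimalDiscriminantInt)
    (htwo : ∃ (ℓ₁ ℓ₂ : ℕ) (_ : Fact ℓ₁.Prime) (_ : Fact ℓ₂.Prime), ℓ₁ ≠ ℓ₂ ∧
      W.HasMultiplicativeReductionAtPrime ℓ₁ ∧ W.HasMultiplicativeReductionAtPrime ℓ₂)
    (htam : ¬ p ∣ W.tamagawaProduct) (hr : W.analyticRank = 1) (hK : IsImaginaryQuadratic K) (hodd : Odd (NumberField.discr K))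
    (hlt : NumberField.discr K < -4) (hH : SatisfiesHeegnerHypothesis (W.conductorNorm ℤ) K)
    (hL : (W.quadraticTwist (NumberField.discr K : ℚ)).entireLFunction 1 ≠ 0)
    (hβ : (4 * (W.conductorNorm ℤ : ℤ)) ∣ β ^ 2 - NumberField.discr K) (hcM : ¬ (p : ℤ) ∣ Dt.c)
    (hseed : ∃ (n : ℕ) (d : KolyvaginHeegnerData Dt β ι n),
      KolyvaginDescent.KolSupp (Zhang2014.IsKolyvaginPrime (W.conductorNorm ℤ) W K p) n ∧ d.kolyvaginClass (Fact.out : p.Prime) 1 ≠ 0) :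
    ∀ (c : K ≃ₐ[ℚ] K), c ≠ 1 → ∀ [Module (ZMod p) (Vp W K p)], Nonempty (LevelKolyvaginSystemP W K p Dt β ι c) := by
  intro c hc1 _
  -- the seed, re-indexed by a finite set of Kolyvagin primes
  obtain ⟨n, d, hsupp, hd⟩ := hseed
  obtain ⟨m, hm⟩ := exists_finset_prod_eq_of_kolSupp hsupp
  have seed : ∃ (m : Finset {ℓ // Zhang2014.IsKolyvaginPrime (W.conductorNorm ℤ) W K p ℓ})
      (d : KolyvaginHeegnerData Dt β ι (∏ ℓ ∈ m, (ℓ : ℕ))), d.kolyvaginClass (Fact.out : p.Prime) 1 ≠ 0 :=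
    ⟨m, by rw [hm]; exact ⟨d, hd⟩⟩
  -- the mixed spaces and (Twin) for them — a theorem now
  obtain ⟨Mix, hMix, hfin⟩ := exists_mixedSpaces W K p c ι
  obtain ⟨hDrop, hRise, hJump⟩ := twin_of_poitouTate W p K c ι hp5 hs hK hlt hc1 (hDual.2 K) Mix hMix hfin
  exact nonempty_levelKolyvaginSystemP_of_seed_of_twin W K p c ι Dt β hK hp5 hs hc1 hH hβ (hDual.2 K)
    (odd_finrank_selQP_empty_of_published W K p c Dt β ι hPUB hDual hp5 hadd hs hsp htwo htam hr hK hodd hH hL hβ hcM)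
    Mix hMix hfin hDrop hRise hJump seed

/-- **KS′ FROM KPA′, PUB AND DUAL — all BY NAME, no displayed binder.** `PublishedInputsAdditiveKoly → PublishedDualityInputsAdditiveKoly →
KolyvaginPrimitiveAdditive → LevelKolyvaginSystemsAdditive`: at every ♯ frame KPA′ supplies the seed and
`nonempty_levelKolyvaginSystemP_of_kolyvaginClass_ne_zero_of_published` the system (equivalently: width seat akr-p2x-w2's
`levelKolyvaginSystemsAdditive_of_kolyvaginPrimitive_of_twin`, p626643 §2, with its one displayed binder (Twin) DISCHARGED by `twin_of_poitouTate`).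
[cite: WZhang2014, Thm. 4.3, Thm. 7.2, §8.1, §9] [cite: Howard2004HeegnerKolyvagin, Lemma 2.5.3, Lemma 2.6.4] [cite: McCallumLMS1991, Cor. 3.2] -/
theorem levelKolyvaginSystemsAdditive_of_kolyvaginPrimitiveAdditive_of_published (hPUB : PublishedInputsAdditiveKoly)
    (hDual : PublishedDualityInputsAdditiveKoly) (hKPA : KolyvaginPrimitiveAdditive) : LevelKolyvaginSystemsAdditive := by
  intro W _ _ _ p _ K _ _ Dt β ι hp5 hadd hs hsp htwo htam hr hK hodd hlt hH hL hβ hcM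
  exact nonempty_levelKolyvaginSystemP_of_kolyvaginClass_ne_zero_of_published hPUB hDual W p K Dt β ι hp5 hadd hs hsp htwo htam hr
    hK hodd hlt hH hL hβ hcM (hKPA W p K Dt β ι hp5 hadd hs hsp htwo htam hr hK hodd hlt hH hL hβ hcM)

/-- **KS′ ⟺ KPA′ modulo the route's two PUBLISHED bundles, BY NAME.** `PublishedInputsAdditiveKoly → PublishedDualityInputsAdditiveKoly →
(LevelKolyvaginSystemsAdditive ↔ KolyvaginPrimitiveAdditive)`: (→) the tree's BOT′-free kernel
`kolyvaginPrimitiveAdditive_of_published_of_levelSystems` (parity P + bottom + rank lowering A1 + LOC + the induction engine); (←)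
`levelKolyvaginSystemsAdditive_of_kolyvaginPrimitiveAdditive_of_published`. So the crux r8 of route `AdditiveKolyvaginRoad` carries no content beyond
its crux r2 and the published inputs: director ruling W-84 (α) in the kernel. [cite: WZhang2014, Thm. 1.1, Thm. 9.1, §9] -/
theorem levelKolyvaginSystemsAdditive_iff_kolyvaginPrimitiveAdditive_of_published (hPUB : PublishedInputsAdditiveKoly)
    (hDual : PublishedDualityInputsAdditiveKoly) : LevelKolyvaginSystemsAdditive ↔ KolyvaginPrimitiveAdditive :=
  ⟨kolyvaginPrimitiveAdditive_of_published_of_levelSystems hPUB hDual,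
    levelKolyvaginSystemsAdditive_of_kolyvaginPrimitiveAdditive_of_published hPUB hDual⟩

end Summit.BirchSwinnertonDyer.BirchSwinnertonDyer.Theorems.AdditiveKoly

end
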